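import Mathlib
import Summits.PneNP.PneNP.Theses.SymmetryBudget
import Summits.PneNP.PneNP.Theorems.SymmetryBudgetWindowBarrierCoreReduction
import Summits.PneNP.PneNP.Theorems.SymmetryBudgetWindowBarrierStubHeaderHardwiring
import Summits.PneNP.PneNP.Theorems.SymmetryBudgetWindowBarrierStubAddressableBitLanguage

/-!
# Capstones for crux `SymmetryBudget.WindowBarrier` (item stmt-PneNP-2145): the crux from its open cores

Kernel-checked compositions recording EXACTLY what the crux
`Summit.PneNP.PneNP.Theses.SymmetryBudget.WindowBarrier` still needs, over LANDED theorems only: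

* `WindowBarrierCapstone.windowBarrier_restated` — the composition of line `canonical-form-completeness`
  (S1 complete invariant → S2 addressable language → S3 header hard-wiring → S4 fooling pairs → crux,
  restated over `HasSymCircuit` / `pointStabiliserBudget`), verbatim from the line skeletons, now in the
  Theorems lane;
* `windowBarrier_of_completeInvariant_of_coreFooling : CompleteInvariantFP → (★) → WindowBarrier` — the crux is the
  conjunction of a polynomial-time complete invariant for `Bud`-isomorphism (conclusion of the landed S1b
  `stub_completeInvariantFP_of_canonicalForm`, p79807, i.e. ONE literature debt: Babai–Luks 1983 canonical forms,
  named fact `Literature.Computability.Complexity.babaiLuks1983_canonicalForm`) and ONE open core, the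
  square-symmetric fooling statement (★) `CoreFooling` (hypothesis of the landed `stub_coreReduction`, p77230):
  composed from `stub_addressableBitLanguage` (p76488), `stub_headerHardwiring` (p74277), `stub_coreReduction` (p77230).

Both theorems take their open parts as HYPOTHESES (no `sorry`, no new axiom); they are support lemmas of
the item (they do not close it). Line `bijection-gauge-twin-iso` (lead prover-line-stmt-PneNP-2145-0) adds
its own capstone `… → TwinIsoHard → WindowBarrier` in a later file once its stubs S_P/S_T are in the tree.
-/

-- `Summit.PneNP.PneNP.…` duplicates `PneNP` BY DESIGN (single-problem summit, D-0017).
set_option linter.dupNamespace false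

namespace Summit.PneNP.PneNP.Theorems

open Literature.Computability.Complexity Filter
open scoped Classical

namespace WindowBarrierCapstone

/-- A gate-free input circuit `x ↦ x q` is symmetric under any set of permutations fixing both
coordinates of `q`. (Folklore; verbatim from the line skeletons `Lines/canonical-form-completeness.lean`, `Lines/young_transport_plan.lean`.) -/
theorem input_isSymmetricUnder {m : ℕ} (Γ : Set (Equiv.Perm (Fin m))) (q : Fin m × Fin m)
    (hq : ∀ ρ ∈ Γ, ρ q.1 = q.1 ∧ ρ q.2 = q.2) :
    (Circuit.input q).IsSymmetricUnder Γ := by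
  intro ρ hρ
  refine ⟨1, ?_, ?_⟩
  · show Sum.inl (ρ q.1, ρ q.2) = Sum.inl q
    rw [(hq ρ hρ).1, (hq ρ hρ).2]
  · intro j
    exact absurd j.2 (Nat.not_lt_zero _)

/-- **The picked line's composition `S1 → S2 → S3 → S4 → WindowBarrier`** (sorry-free; verbatim
`windowBarrier_restated` of `Lines/canonical-form-completeness.lean`, reproduced so that this skeleton
depends only on LANDED Theorems files): `L` from S2 applied to the `F` of S1; given `p`, S4 at `p + 2`
yields, frequently in `m` (and eventually `m ≥ m₁`), a fooling pair `(x, y)`; it agrees on the header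
(input wires are symmetric circuits of size `0`), so S2 gives a header `h` on which `L` separates the
overwritten pair; a symmetric circuit of size `≤ p m` for the slice would, by S3, give one of size
`≤ p m + 2` for the overwritten slice, which the pair fools — contradiction. -/
theorem windowBarrier_restated
    (h₁ : ∃ F ∈ FP, ∃ m₀ : ℕ, ∀ m : ℕ, m₀ ≤ m → ∀ x y : Fin m × Fin m → Bool,
      (F (encodingGraph.encode ⟨m, SimpleGraph.fromRel fun u v => x (u, v) = true⟩) =
          F (encodingGraph.encode ⟨m, SimpleGraph.fromRel fun u v => y (u, v) = true⟩) ↔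
        ∃ ρ ∈ pointStabiliserBudget m (Nat.log 2 m),
          (SimpleGraph.fromRel fun u v => x (ρ u, ρ v) = true) =
            (SimpleGraph.fromRel fun u v => y (u, v) = true)))
    (h₂ : ∀ F ∈ FP, ∀ m₀ : ℕ,
      (∀ m : ℕ, m₀ ≤ m → ∀ x y : Fin m × Fin m → Bool,
        (F (encodingGraph.encode ⟨m, SimpleGraph.fromRel fun u v => x (u, v) = true⟩) =
            F (encodingGraph.encode ⟨m, SimpleGraph.fromRel fun u v => y (u, v) = true⟩) ↔
          ∃ ρ ∈ pointStabiliserBudget m (Nat.log 2 m),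
            (SimpleGraph.fromRel fun u v => x (ρ u, ρ v) = true) =
              (SimpleGraph.fromRel fun u v => y (u, v) = true))) →
      ∃ L ∈ Classes.P, ∃ t : ℕ → ℕ, ∃ m₁ : ℕ,
        (∀ m : ℕ, ∀ ρ ∈ pointStabiliserBudget m (Nat.log 2 m), ∀ x : Fin m × Fin m → Bool,
          encodingGraph.encode ⟨m, SimpleGraph.fromRel fun u v => x (ρ u, ρ v) = true⟩ ∈ L ↔
            encodingGraph.encode ⟨m, SimpleGraph.fromRel fun u v => x (u, v) = true⟩ ∈ L) ∧
        (∀ m : ℕ, m₁ ≤ m → t m + Nat.log 2 m ≤ m) ∧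
        (∀ m : ℕ, m₁ ≤ m → ∀ x y : Fin m × Fin m → Bool,
          (∀ q : Fin m × Fin m, (q.1 : ℕ) < t m → (q.2 : ℕ) < t m → x q = y q) →
          (¬ ∃ ρ ∈ pointStabiliserBudget m (Nat.log 2 m),
              (SimpleGraph.fromRel fun u v => x (ρ u, ρ v) = true) =
                (SimpleGraph.fromRel fun u v => y (u, v) = true)) →
          ∃ h : Fin m × Fin m → Bool,
            ¬ (encodingGraph.encode ⟨m, SimpleGraph.fromRel fun u v =>
                    (if (u : ℕ) < t m ∧ (v : ℕ) < t m then h (u, v) else x (u, v)) = true⟩ ∈ L ↔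
                encodingGraph.encode ⟨m, SimpleGraph.fromRel fun u v =>
                    (if (u : ℕ) < t m ∧ (v : ℕ) < t m then h (u, v) else y (u, v)) = true⟩ ∈ L)))
    (h₃ : ∀ (m t s : ℕ) (Γ : Set (Equiv.Perm (Fin m))),
      (∀ ρ ∈ Γ, ∀ i : Fin m, (i : ℕ) < t → ρ i = i) →
      ∀ (f : (Fin m × Fin m → Bool) → Bool) (h : Fin m × Fin m → Bool),
        HasSymCircuit tcBasis Γ s f →
        HasSymCircuit tcBasis Γ (s + 2)
          (fun x => f (fun q => if (q.1 : ℕ) < t ∧ (q.2 : ℕ) < t then h q else x q)))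
    (h₄ : ∀ p : Polynomial ℕ, ∃ᶠ m in atTop, ∃ x y : Fin m × Fin m → Bool,
      (¬ ∃ ρ ∈ pointStabiliserBudget m (Nat.log 2 m),
          (SimpleGraph.fromRel fun u v => x (ρ u, ρ v) = true) =
            (SimpleGraph.fromRel fun u v => y (u, v) = true)) ∧
      ∀ C : Circuit (Fin m × Fin m), C.IsOver tcBasis → C.size ≤ p.eval m →
        C.IsSymmetricUnder (pointStabiliserBudget m (Nat.log 2 m)) → C.eval x = C.eval y) :
    ∃ L ∈ Classes.P,
      (∀ m : ℕ, ∀ ρ ∈ pointStabiliserBudget m (Nat.log 2 m), ∀ x : Fin m × Fin m → Bool,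
        encodingGraph.encode ⟨m, SimpleGraph.fromRel fun u v => x (ρ u, ρ v) = true⟩ ∈ L ↔
          encodingGraph.encode ⟨m, SimpleGraph.fromRel fun u v => x (u, v) = true⟩ ∈ L) ∧
      ∀ p : Polynomial ℕ, ∃ᶠ m in atTop,
        ¬ HasSymCircuit tcBasis (pointStabiliserBudget m (Nat.log 2 m)) (p.eval m)
            (fun x : Fin m × Fin m → Bool =>
              decide (encodingGraph.encode ⟨m, SimpleGraph.fromRel fun u v => x (u, v) = true⟩ ∈ L)) := by
  obtain ⟨F, hF, m₀, hcomp⟩ := h₁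
  obtain ⟨L, hLP, t, m₁, hinv, hfit, hsep⟩ := h₂ F hF m₀ hcomp
  refine ⟨L, hLP, hinv, fun p => ?_⟩
  have hfool := h₄ (p + 2)
  refine (hfool.and_eventually (eventually_ge_atTop m₁)).mono ?_
  rintro m ⟨⟨x, y, hniso, hxy⟩, hm⟩ hsym
  -- `Bud` fixes the header pointwise
  have hfix : ∀ ρ ∈ pointStabiliserBudget m (Nat.log 2 m), ∀ i : Fin m, (i : ℕ) < t m → ρ i = i := by
    intro ρ hρ i hi
    have hle := hfit m hm
    exact hρ i (by omega)
  -- the fooling pair agrees on the header block (input wires there are symmetric circuits of size 0)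
  have hagree : ∀ q : Fin m × Fin m, (q.1 : ℕ) < t m → (q.2 : ℕ) < t m → x q = y q := by
    intro q hq₁ hq₂
    have hO : (Circuit.input q).IsOver tcBasis := by
      intro g hg
      simp [Circuit.input] at hg
    have hS : (Circuit.input q).IsSymmetricUnder (pointStabiliserBudget m (Nat.log 2 m)) :=
      input_isSymmetricUnder _ q fun ρ hρ => ⟨hfix ρ hρ q.1 hq₁, hfix ρ hρ q.2 hq₂⟩
    have hsz : (Circuit.input q).size ≤ (p + 2).eval m := by
      rw [Circuit.size_input]
      exact Nat.zero_le _
    simpa using hxy (Circuit.input q) hO hsz hS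
  obtain ⟨h, hh⟩ := hsep m hm x y hagree hniso
  obtain ⟨C, hCO, hCs, hCsym, hCcomp⟩ :=
    h₃ m (t m) (p.eval m) (pointStabiliserBudget m (Nat.log 2 m)) hfix _ h hsym
  apply hh
  have hsize : C.size ≤ (p + 2).eval m := by
    have : (p + 2 : Polynomial ℕ).eval m = p.eval m + 2 := by
      simp [Polynomial.eval_add]
    omega
  have hev := hxy C hCO hsize hCsym
  rw [hCcomp x, hCcomp y] at hev
  exact decide_eq_decide.mp hev


end WindowBarrierCapstone

open WindowBarrierCapstone

/-- **Capstone of line `canonical-form-completeness` (complete-invariant form): the crux from a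
polynomial-time complete invariant for `Bud`-isomorphism and the square-symmetric core (★).** If some
`F ∈ FP` is, for all large `m`, a complete invariant of `Bud(m,⌊log₂ m⌋)`-isomorphism on graph codes
(the conclusion of the landed S1b `stub_completeInvariantFP_of_canonicalForm`, p79807, which derives it
from Babai–Luks canonical forms) and (★) `CoreFooling` holds — for every `d`, for infinitely many `g`,
two non-isomorphic `g`-vertex graphs fool every `Sym(Fin g)`-symmetric `tcBasis`-circuit with at most
`2^{dg}` gates — then `SymmetryBudget.WindowBarrier` holds. Pure composition of landed theorems: S2
(`stub_addressableBitLanguage`), S3 (`stub_headerHardwiring`), the core reduction (`stub_coreReduction`)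
and `windowBarrier_restated`; the route decl's inline `let Sym … HasSym … Bud … Gr …` prelude is
definitionally `Circuit.IsSymmetricUnder` / `HasSymCircuit tcBasis` / `pointStabiliserBudget` /
`SimpleGraph.fromRel`. So, in the tree: `WindowBarrier ⟸ {babaiLuks1983_canonicalForm, (★)}`. -/
theorem windowBarrier_of_completeInvariant_of_coreFooling :
    (∃ F ∈ FP, ∃ m₀ : ℕ, ∀ m : ℕ, m₀ ≤ m → ∀ x y : Fin m × Fin m → Bool,
      (F (encodingGraph.encode ⟨m, SimpleGraph.fromRel fun u v => x (u, v) = true⟩) =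
          F (encodingGraph.encode ⟨m, SimpleGraph.fromRel fun u v => y (u, v) = true⟩) ↔
        ∃ ρ ∈ pointStabiliserBudget m (Nat.log 2 m),
          (SimpleGraph.fromRel fun u v => x (ρ u, ρ v) = true) =
            (SimpleGraph.fromRel fun u v => y (u, v) = true))) →
    (∀ d : ℕ, ∃ᶠ g in atTop, ∃ G₁ G₂ : SimpleGraph (Fin g), ¬ Nonempty (G₁ ≃g G₂) ∧
      ∀ C : Circuit (Fin g × Fin g), C.IsOver tcBasis → C.size ≤ 2 ^ (d * g) →
        C.IsSymmetricUnder Set.univ →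
          C.eval (fun p : Fin g × Fin g => decide (G₁.Adj p.1 p.2)) =
            C.eval (fun p : Fin g × Fin g => decide (G₂.Adj p.1 p.2))) →
    Summit.PneNP.PneNP.Theses.SymmetryBudget.WindowBarrier := by
  intro hS1 hcore
  have hS4 := stub_coreReduction hcore
  have H := windowBarrier_restated hS1 stub_addressableBitLanguage stub_headerHardwiring hS4
  exact H

end Summit.PneNP.PneNP.Theorems
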